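import Summits.QuantumAdvantage.QuantumAdvantage.Theorems.SosSandwichTransferPBNodeBounds
import Literature.Computability.Cryptography.QuantumCircuitOracleCountFP
import Literature.Computability.Complexity.FoldBricks
import HarnessLib

/-!
# Crux `TransferPB` (stmt-QuantumAdvantage-15238, route SosSandwich), line `birth` — the influence threshold as a polynomial-time numeral

Support for the last obligation (Q) `nodeProblem F r c k ∈ PromiseBQP`. The BLOCK / SINGLE node tests compare a magnitude
with the threshold `w = pbThreshold F x r c k = 1 / W(n)`, `W(n) = 2^k · (400 · (r(n)+1) · d(n))^c`, `d(n) = 2T(n) + 1`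
(`Theorems/SosSandwichTransferPBNodeBounds.lean`, `pbThreshold_eq`). The amplification-by-threshold layer
(`Literature/…/PolyThreshold.lean`, `mem_PromiseBQP_of_thresholds_pre`) reads its rational threshold `⟦num⟧/⟦den⟧` off the
instance by `FP` string functions; this file supplies the denominator side: **`W(n)` is an `FP` numeral of the input**,
assembled from the oracle count `T(n)` (`QCircuitFamily.oracleCountFn`, in `FP` for uniform `F`,
`Literature/…/QuantumCircuitOracleCountFP.lean`), the numeral `r(n)+1` (`lenBinF ∘ polyFn (r+1)`) and the arithmetic bricks
`prodFn`, `addFn`.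

* `powNumFn c f` — `z ↦ bin (⟦f z⟧^c)` (iterated `prodFn`); `degFn F` — `z ↦ bin d(|z|)`; `baseFn F r` —
  `z ↦ bin (400 (r(|z|)+1) d(|z|))`; **`wDenFn F r c k`** — `z ↦ bin W(|z|)`; values on every input and membership in `FP`
  (for uniform `F`);
* **`pbThreshold_eq_inv_wDenFn`** — `pbThreshold F x r c k = 1 / ⟦wDenFn F r c k x⟧`; `wDenFn_pos`.

All proved; the definitions are explicit string functions (bodies given). Sources: S. Aaronson, A. Ambainis, Theory Comput. 10
(2014), proof of Thm. 23 (p. 14); S. Arora, B. Barak, Computational Complexity (CUP 2009), §1.3, §6.2.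
-/

-- D-0017: single-conjunct summit ⇒ the duplicate `QuantumAdvantage.QuantumAdvantage` is mandated.
set_option linter.dupNamespace false

noncomputable section

namespace Summit.QuantumAdvantage.QuantumAdvantage.Cruxes.TransferPB.Birth

open Finset Literature.Computability.Cryptography Literature.Computability.Complexity
  Literature.Computability.Complexity.Brick Literature.Computability.Complexity.Plumb
  Literature.Computability.QuantumComplexity Literature.Computability.QuantumComplexity.ClassicalSimulation
open _root_.Computability

namespace SimTreePB

/-! ### Iterated product numeral -/

/-- `powNumFn c f z = bin (⟦f z⟧^c)`: the `c`-fold product of the numeral `f z` (iterated `prodFn`).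
[cite: AroraBarak2009, §1.3 (schoolbook arithmetic in polynomial time)] -/
def powNumFn (c : ℕ) (f : List Bool → List Bool) : List Bool → List Bool :=
  Nat.rec (fun _ => encodeNat 1) (fun _ g => prodFn ∘ fanoutFn f g) c

/-- Value of `powNumFn`. [cite: AroraBarak2009, §1.3] -/
@[simp] theorem powNumFn_apply (f : List Bool → List Bool) : ∀ (c : ℕ) (z : List Bool),
    powNumFn c f z = encodeNat (bitsToNat (f z) ^ c)
  | 0, z => by simp [powNumFn]
  | c + 1, z => by
    have ih := powNumFn_apply f c z
    simp only [powNumFn] at ih ⊢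
    simp only [Function.comp_apply, fanoutFn_apply, prodFn_boolPair, ih, bitsToNat_encodeNat, pow_succ']

/-- `powNumFn c f ∈ FP` for `f ∈ FP`. [cite: AroraBarak2009, §1.3] -/
theorem powNumFn_mem_FP {f : List Bool → List Bool} (hf : f ∈ FP) : ∀ c : ℕ, powNumFn c f ∈ FP
  | 0 => const_mem_FP _
  | c + 1 => by
    have ih := powNumFn_mem_FP hf c
    simp only [powNumFn] at ih ⊢
    exact comp_mem_FP prodFn_mem_FP (fanoutFn_mem_FP hf ih)

/-! ### The degree, the base and the threshold denominator -/

variable (F : QCircuitFamily cliffordT) (r : Polynomial ℕ) (c k : ℕ)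

/-- `degFn F z = bin d(|z|)`, `d = 2T + 1`. [cite: AaronsonAmbainis2014, Thm. 23 (proof, p. 14)] -/
def degFn : List Bool → List Bool :=
  addFn ∘ fanoutFn (prodFn ∘ fanoutFn (fun _ => encodeNat 2) F.oracleCountFn) (fun _ => encodeNat 1)

/-- Value of `degFn`: the numeral of `thm23Degree`. [cite: AaronsonAmbainis2014, Thm. 23 (proof, p. 14)] -/
@[simp] theorem degFn_apply (z : List Bool) : degFn F z = encodeNat (thm23Degree F z) := by
  simp [degFn, fanoutFn_apply, QCircuitFamily.oracleCountFn_apply, thm23Degree]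

/-- `degFn F ∈ FP` for uniform `F`. [cite: AroraBarak2009, §6.2 Def. 6.12, Remark 6.7] -/
theorem degFn_mem_FP (hU : F.IsUniform) : degFn F ∈ FP :=
  comp_mem_FP addFn_mem_FP (fanoutFn_mem_FP
    (comp_mem_FP prodFn_mem_FP (fanoutFn_mem_FP (const_mem_FP _) (QCircuitFamily.oracleCountFn_mem_FP hU)))
    (const_mem_FP _))

/-- `baseFn F r z = bin (400 · (r(|z|)+1) · d(|z|))`. [cite: AaronsonAmbainis2014, Thm. 23 (proof, p. 14)] -/
def baseFn : List Bool → List Bool :=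
  prodFn ∘ fanoutFn (fun _ => encodeNat 400) (prodFn ∘ fanoutFn (lenBinF ∘ polyFn (r + 1)) (degFn F))

/-- Value of `baseFn`. [cite: AaronsonAmbainis2014, Thm. 23 (proof, p. 14)] -/
@[simp] theorem baseFn_apply (z : List Bool) :
    baseFn F r z = encodeNat (400 * ((r.eval z.length + 1) * thm23Degree F z)) := by
  simp [baseFn, fanoutFn_apply, ones, Polynomial.eval_add]

/-- `baseFn F r ∈ FP` for uniform `F`. [cite: AroraBarak2009, §1.3] -/
theorem baseFn_mem_FP (hU : F.IsUniform) : baseFn F r ∈ FP :=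
  comp_mem_FP prodFn_mem_FP (fanoutFn_mem_FP (const_mem_FP _)
    (comp_mem_FP prodFn_mem_FP (fanoutFn_mem_FP (comp_mem_FP lenBinF_mem_FP (polyFn_mem_FP _)) (degFn_mem_FP F hU))))

/-- **The threshold denominator** `wDenFn F r c k z = bin W(|z|)`, `W = 2^k · (400 (r+1) d)^c`.
[cite: AaronsonAmbainis2014, Thm. 23 (proof, p. 14)] -/
def wDenFn : List Bool → List Bool :=
  prodFn ∘ fanoutFn (fun _ => encodeNat (2 ^ k)) (powNumFn c (baseFn F r))

/-- Value of `wDenFn`. [cite: AaronsonAmbainis2014, Thm. 23 (proof, p. 14)] -/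
@[simp] theorem wDenFn_apply (z : List Bool) :
    wDenFn F r c k z = encodeNat (2 ^ k * (400 * ((r.eval z.length + 1) * thm23Degree F z)) ^ c) := by
  simp [wDenFn, fanoutFn_apply]

/-- **`wDenFn ∈ FP`** for uniform `F`. [cite: AroraBarak2009, §1.3, §6.2] -/
theorem wDenFn_mem_FP (hU : F.IsUniform) : wDenFn F r c k ∈ FP :=
  comp_mem_FP prodFn_mem_FP (fanoutFn_mem_FP (const_mem_FP _) (powNumFn_mem_FP (baseFn_mem_FP F r hU) c))

/-- The denominator is positive. [cite: AaronsonAmbainis2014, Thm. 23 (proof, p. 14)] -/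
theorem wDenFn_pos (z : List Bool) : 0 < bitsToNat (wDenFn F r c k z) := by
  rw [wDenFn_apply, bitsToNat_encodeNat]
  have hd : 0 < thm23Degree F z := thm23Degree_pos F z
  positivity

/-- **The threshold is the reciprocal of the `FP` numeral**: `pbThreshold F x r c k = 1 / ⟦wDenFn F r c k x⟧`.
[cite: AaronsonAmbainis2014, Thm. 23 (proof, p. 14)] -/
theorem pbThreshold_eq_inv_wDenFn (x : List Bool) :
    pbThreshold F x r c k = 1 / (bitsToNat (wDenFn F r c k x) : ℝ) := by
  rw [pbThreshold_eq, wDenFn_apply, bitsToNat_encodeNat]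
  push_cast
  ring

end SimTreePB

end Summit.QuantumAdvantage.QuantumAdvantage.Cruxes.TransferPB.Birth

end
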